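import Mathlib.Analysis.MellinInversion
import Mathlib.Analysis.Fourier.FourierTransformDeriv
import Mathlib.Analysis.Calculus.SmoothSeries
import Mathlib.Analysis.Calculus.Deriv.Polynomial
import Mathlib.Analysis.Calculus.Deriv.Shift
import Mathlib.MeasureTheory.Integral.ExpDecay
import Mathlib.NumberTheory.LSeries.RiemannZeta
import Literature.NumberTheory.LFunctions.RiemannXi
import HarnessLib

/-!
# Riemann's Fourier representation of `Ξ` and the integral `∫₀^∞ Ξ(t) dt`

Topic `Literature/NumberTheory/LFunctions` (companion of `RiemannXi.lean`, `RiemannXiPrimitive.lean`).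

Riemann (1859) wrote `Ξ(t) = ξ(1/2 + it)` as a cosine transform
`Ξ(t) = 4∫₁^∞ (x^{3/2}ψ′(x))′ x^{−1/4} cos(½ t log x) dx = 2∫₀^∞ Φ(u) cos(tu) du`,
`Φ(u) = Σ_{n≥1} (4π²n⁴e^{9u/2} − 6πn²e^{5u/2}) e^{−πn²e^{2u}}` (Titchmarsh 1986, §10.1,
eqs. (10.1.1)–(10.1.4); Lagarias–Montague 2011, Lemma 3.1, eqs. (3.3)–(3.4)), and "by Fourier's
integral theorem" `Φ(u) = (1/π)∫₀^∞ Ξ(t) cos(ut) dt` (Titchmarsh §10.4). This file PROVES the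
representation from Mathlib's definition of the completed zeta function, in the normalisation

* `riemannXi (1/2 + t I) = 𝓕 Ψ (t / 4π)` (`riemannXi_criticalLine_eq_fourier`), where `𝓕` is
  Mathlib's Fourier transform on `ℝ` and `Ψ(u) = Σ_{n≥1} (2π²n⁴e^{2u} − 3πn²eᵘ) e^{u/4 − πn²eᵘ}`
  (`LagariasMontague.Psi`; `Ψ(u) = ½ Φ(u/2)`),

equivalently, as printed, `ξ(1/2 + it) = 2∫₀^∞ Φ(u) cos(tu) du` with `Φ(u) = 2Ψ(2u)`
(`riemannXi_criticalLine_eq_integral_cos`, `two_mul_Psi_two_mul`), and deduces, by Fourier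
inversion at `0` (Mathlib's `Integrable.fourierInv_fourier_eq`),

* `Ξ` is integrable on `ℝ` (`integrable_riemannXi_criticalLine`),
* `∫_ℝ ξ(1/2 + it) dt = 4π Ψ(0)` and `∫₀^∞ ξ(1/2 + it) dt = 2π Ψ(0)`
  (`integral_riemannXi_criticalLine`, `integral_riemannXi_criticalLine_Ioi`), with
  `Ψ(0) = Σ (2π²n⁴ − 3πn²)e^{−πn²} > 0` (`Psi_zero`, `Psi_zero_pos`); `2πΨ(0) = πΦ(0) = A₀ ≈ 2.80668`
  is the constant of Lagarias–Montague, Thm. 2.1 (1).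

## Proof architecture (Riemann; Lagarias–Montague Lemma 3.1, with Mathlib shortcuts)

1. *Theta series.* For a real polynomial `p` put `S_p(u) := Σ_{n≥0} p(a_n eᵘ) e^{u/4 − a_n eᵘ}`,
   `a_n = π(n+1)²` (`thetaSeries`). Termwise differentiation (`hasDerivAt_tsum_of_isPreconnected`)
   gives `S_p′ = S_{δp}`, `δp = Xp′ + (1/4 − X)p` (`hasDerivAt_thetaSeries`); `|S_p(u)| ≤ C e^{u/4 − (π/4)eᵘ}`
   on `u ≥ −R`, so `S_p` is integrable on `(0,∞)` and tends to `0`. `h := S_2 = e^{u/4}(θ(eᵘ) − 1)`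
   (`thetaH_eq`, `θ = HurwitzZeta.evenKernel 0`), `Ψ := S_{2X²−3X} = h″ − h/16` (`Psi_eq_thetaH`).
2. *Parity from Jacobi's transformation law.* `G(u) := e^{u/4}θ(eᵘ) = h + e^{u/4}` is EVEN
   (`thetaG_neg`, from `evenKernel_functional_equation`), hence `h′(0) = −1/4`
   (`thetaSeries_δ_two_zero`), `Ψ = G″ − G/16` is even and `Ψ′` odd, so `Ψ, Ψ′, Ψ″ ∈ L¹(ℝ)`.
3. *Mellin side.* Mathlib defines `Λ₀(s) = mellin f_modif (s/2) / 2` with `f_modif` the modified theta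
   kernel; `mellin_eq_fourier` turns this into `Λ₀(1/2 + it) = 𝓕 g (t/4π)/2` with `g = h ∘ |·|` a.e.
   (`mellinSide_eq_thetaH`), so `ξ(1/2 + it) = 1/2 − (t²/4 + 1/16) ∫₀^∞ h c_{t/2}`,
   `c_a(u) = e^{iau} + e^{−iau}`.
4. *Two integrations by parts on `(0,∞)`* (`integral_Ioi_mul_deriv_eq_deriv_mul`):
   `∫₀^∞ Ψ c_a = 1/2 − (a² + 1/16)∫₀^∞ h c_a` (`integral_Psi_mul_cosW`; the `1/2` is the boundary
   term `−2h′(0)`), whence `ξ(1/2 + it) = ∫₀^∞ Ψ c_{t/2} = 𝓕 Ψ (t/4π)`.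
5. *Inversion.* `𝓕 Ψ″ = (2πiw)² 𝓕 Ψ` (`Real.fourier_deriv` twice) gives `|𝓕Ψ(w)| ≤ C/(1 + w²)`, so
   `𝓕Ψ ∈ L¹` and `∫_ℝ 𝓕Ψ = 𝓕⁻(𝓕Ψ)(0) = Ψ(0)`.

Deviation from the printed sources: Riemann/Titchmarsh integrate by parts in the variable `x = e^{2u}`;
Lagarias–Montague obtain `lim ∫₀^T Ξ = πΦ(0)` (their §4) from the Dirichlet integral `∫₀^∞ sin v/v = π/2`,
which Mathlib lacks — Fourier inversion replaces it. Deliberately NOT here: the decay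
`|Ξ(t)| ≤ C e^{−πt/4}(|t|+1)^{5/2}` (LM Lemma 3.3 (1), the named fact `norm_riemannXi_le_of_mem_strip_LM`),
positivity/monotonicity of `Φ` (Wintner), and the rate `Ξ^{(-1)}(t) = A₀ + O(t^{−2/3})`.

## References

* B. Riemann, *Ueber die Anzahl der Primzahlen unter einer gegebenen Grösse*, Monatsber. Berlin
  1859 — the cosine-integral representation of `Ξ`. [key `Riemann1859`]
* J. C. Lagarias, D. Montague, *The integral of the Riemann ξ-function*, Comment. Math. Univ. St. Pauli
  60 (2011) 143–169, arXiv:1106.4348 — Lemma 3.1 (eq. (3.3), (3.4)), Thm. 2.1 (1), §4.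
  [key `LagariasMontague2011`]
* E. C. Titchmarsh, *The Theory of the Riemann Zeta-Function*, 2nd ed. (rev. D. R. Heath-Brown),
  Oxford 1986, §10.1 eqs. (10.1.1)–(10.1.4) (Riemann's formula), §10.4 (Fourier's integral theorem
  for `Φ`). [key `Titchmarsh1986`]
-/

noncomputable section

open Real Filter Set MeasureTheory HurwitzZeta Polynomial
open scoped Topology

namespace Literature.NumberTheory.LFunctions

namespace LagariasMontague

/-! ## Part I — theta series attached to polynomials -/

/-- The weight `a_n := π (n+1)²` of the `n`-th theta term. [folklore] -/
def thetaWeight (n : ℕ) : ℝ := π * ((n : ℝ) + 1) ^ 2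

/-- `π ≤ a_n`. [folklore] -/
theorem pi_le_thetaWeight (n : ℕ) : π ≤ thetaWeight n := by
  unfold thetaWeight
  have h : (1 : ℝ) ≤ ((n : ℝ) + 1) ^ 2 := by nlinarith [n.cast_nonneg (α := ℝ)]
  nlinarith [pi_pos]

/-- `0 < a_n`. [folklore] -/
theorem thetaWeight_pos (n : ℕ) : 0 < thetaWeight n :=
  lt_of_lt_of_le pi_pos (pi_le_thetaWeight n)

/-- The `n`-th term `p(a_n eᵘ) · exp(u/4 − a_n eᵘ)` of the theta series attached to a real
polynomial `p`. [folklore] -/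
def thetaTerm (p : ℝ[X]) (n : ℕ) (u : ℝ) : ℝ :=
  p.eval (thetaWeight n * exp u) * exp (u / 4 - thetaWeight n * exp u)

/-- The operator `δ p := X p' + (1/4 − X) p` on `ℝ[X]`: `d/du` of the `p`-term is the `δ p`-term.
[folklore] -/
def thetaδ (p : ℝ[X]) : ℝ[X] := X * derivative p + (C (1 / 4) - X) * p

/-- `(δ p)(y) = y p'(y) + (1/4 − y) p(y)`. [folklore] -/
@[simp] theorem eval_thetaδ (p : ℝ[X]) (y : ℝ) :
    (thetaδ p).eval y = y * p.derivative.eval y + (1 / 4 - y) * p.eval y := by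
  simp [thetaδ]

/-- `d/du [p(a eᵘ) e^{u/4 − a eᵘ}] = (δ p)(a eᵘ) e^{u/4 − a eᵘ}`. [folklore] -/
theorem hasDerivAt_thetaTerm (p : ℝ[X]) (n : ℕ) (u : ℝ) :
    HasDerivAt (thetaTerm p n) (thetaTerm (thetaδ p) n u) u := by
  unfold thetaTerm
  have hy : HasDerivAt (fun u => thetaWeight n * exp u) (thetaWeight n * exp u) u :=
    (Real.hasDerivAt_exp u).const_mul _
  have h1 : HasDerivAt (fun u => p.eval (thetaWeight n * exp u))
      (p.derivative.eval (thetaWeight n * exp u) * (thetaWeight n * exp u)) u :=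
    (p.hasDerivAt _).comp u hy
  have h2 : HasDerivAt (fun u => exp (u / 4 - thetaWeight n * exp u))
      (exp (u / 4 - thetaWeight n * exp u) * (1 / 4 - thetaWeight n * exp u)) u :=
    (((hasDerivAt_id u).div_const 4).sub hy).exp
  refine (h1.mul h2).congr_deriv ?_
  rw [eval_thetaδ]
  ring

/-- Every real polynomial is `O(e^{y/2})` on `[0, ∞)` with an explicit constant. [folklore] -/
theorem exists_abs_eval_le_exp (p : ℝ[X]) :
    ∃ C, 0 ≤ C ∧ ∀ y, 0 ≤ y → |p.eval y| ≤ C * exp (y / 2) := by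
  induction p using Polynomial.induction_on' with
  | add p q hp hq =>
    obtain ⟨C₁, hC₁, h₁⟩ := hp
    obtain ⟨C₂, hC₂, h₂⟩ := hq
    refine ⟨C₁ + C₂, by positivity, fun y hy => ?_⟩
    rw [eval_add, add_mul]
    exact (abs_add_le _ _).trans (add_le_add (h₁ y hy) (h₂ y hy))
  | monomial n a =>
    refine ⟨|a| * (2 ^ n * n.factorial), by positivity, fun y hy => ?_⟩
    rw [eval_monomial, abs_mul, abs_of_nonneg (pow_nonneg hy n), mul_assoc]
    gcongr
    have h := Real.pow_div_factorial_le_exp (x := y / 2) (by positivity) n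
    rw [div_pow, div_div, div_le_iff₀ (by positivity)] at h
    linarith

/-- The majorant `M(u) := exp(u/4 − (π/4) eᵘ)`. [folklore] -/
def thetaMajorant (u : ℝ) : ℝ := exp (u / 4 - π / 4 * exp u)

/-- `0 < M(u)`. [folklore] -/
theorem thetaMajorant_pos (u : ℝ) : 0 < thetaMajorant u := exp_pos _

/-- `M(u) ≤ e^{−π/4} e^{−((π−1)/4) u}` for all real `u` (from `1 + u ≤ eᵘ`). [folklore] -/
theorem thetaMajorant_le_exp (u : ℝ) :
    thetaMajorant u ≤ exp (-(π / 4)) * exp (-((π - 1) / 4) * u) := by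
  rw [thetaMajorant, ← exp_add, exp_le_exp]
  have := add_one_le_exp u
  nlinarith [pi_pos]

/-- `M(u) ≤ 1`. [folklore] -/
theorem thetaMajorant_le_one (u : ℝ) : thetaMajorant u ≤ 1 := by
  rw [thetaMajorant, exp_le_one_iff]
  have := add_one_le_exp u
  nlinarith [two_le_pi, exp_pos u]

/-- Term bound: for `u ≥ −R`, `|p-term_n(u)| ≤ C_p e^{−(π/4)e^{−R}(n+1)²} M(u)`. [folklore] -/
theorem exists_abs_thetaTerm_le (p : ℝ[X]) : ∃ C, 0 ≤ C ∧ ∀ R : ℝ, ∀ n : ℕ, ∀ u : ℝ, -R ≤ u →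
    |thetaTerm p n u| ≤ C * exp (-(π / 4 * exp (-R) * ((n : ℝ) + 1) ^ 2)) * thetaMajorant u := by
  obtain ⟨C, hC, hp⟩ := exists_abs_eval_le_exp p
  refine ⟨C, hC, fun R n u hu => ?_⟩
  have hw := thetaWeight_pos n
  have hy : 0 ≤ thetaWeight n * exp u := by positivity
  rw [thetaTerm, abs_mul, abs_of_pos (exp_pos _)]
  calc |p.eval (thetaWeight n * exp u)| * exp (u / 4 - thetaWeight n * exp u)
      ≤ C * exp (thetaWeight n * exp u / 2) * exp (u / 4 - thetaWeight n * exp u) := by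
        gcongr; exact hp _ hy
    _ = C * exp (u / 4 - thetaWeight n * exp u / 2) := by
        rw [mul_assoc, ← exp_add]; ring_nf
    _ ≤ C * exp (-(π / 4 * exp (-R) * ((n : ℝ) + 1) ^ 2) + (u / 4 - π / 4 * exp u)) := by
        gcongr
        have h1 : exp (-R) ≤ exp u := exp_le_exp.mpr hu
        have h2 : (1 : ℝ) ≤ ((n : ℝ) + 1) ^ 2 := by nlinarith [n.cast_nonneg (α := ℝ)]
        have h3 : π / 4 * exp (-R) * ((n : ℝ) + 1) ^ 2 ≤ π / 4 * exp u * ((n : ℝ) + 1) ^ 2 := by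
          gcongr
        have h4 : π / 4 * exp u ≤ π / 4 * exp u * ((n : ℝ) + 1) ^ 2 :=
          le_mul_of_one_le_right (by positivity) h2
        have h5 : thetaWeight n * exp u / 2 = 2 * (π / 4 * exp u * ((n : ℝ) + 1) ^ 2) := by
          unfold thetaWeight; ring
        linarith
    _ = C * exp (-(π / 4 * exp (-R) * ((n : ℝ) + 1) ^ 2)) * thetaMajorant u := by
        rw [exp_add, thetaMajorant]; ring

/-- `Σ_n e^{−c (n+1)²}` converges for `c > 0`. [folklore] -/
theorem summable_exp_neg_mul_sq {c : ℝ} (hc : 0 < c) :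
    Summable fun n : ℕ => exp (-(c * ((n : ℝ) + 1) ^ 2)) := by
  have := Real.summable_exp_nat_mul_of_ge (c := -c) (neg_lt_zero.mpr hc)
    (f := fun n : ℕ => ((n : ℝ) + 1) ^ 2) (fun i => by nlinarith [i.cast_nonneg (α := ℝ)])
  convert this using 2 with n
  ring

/-- The theta series `S_p(u) := Σ_n p(a_n eᵘ) exp(u/4 − a_n eᵘ)` converges for every `u`.
[folklore] -/
theorem summable_thetaTerm (p : ℝ[X]) (u : ℝ) : Summable fun n => thetaTerm p n u := by
  obtain ⟨C, hC, h⟩ := exists_abs_thetaTerm_le p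
  refine Summable.of_norm_bounded
    ((((summable_exp_neg_mul_sq (c := π / 4 * exp (- -u)) (by positivity)).mul_left C).mul_right
      (thetaMajorant u))) fun n => ?_
  rw [Real.norm_eq_abs]
  exact h (-u) n u (by simp)

/-- The theta series `S_p(u) := Σ_{n ≥ 0} p(π(n+1)² eᵘ) · exp(u/4 − π(n+1)² eᵘ)` attached to a
real polynomial `p` (so `S_2(u) = e^{u/4}(θ(eᵘ) − 1)` with `θ` Jacobi's theta function).
[cite: LagariasMontague2011, Lemma 3.1] -/
def thetaSeries (p : ℝ[X]) (u : ℝ) : ℝ := ∑' n, thetaTerm p n u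

/-- Termwise differentiation: `S_p' = S_{δ p}`. [folklore] -/
theorem hasDerivAt_thetaSeries (p : ℝ[X]) (u : ℝ) :
    HasDerivAt (thetaSeries p) (thetaSeries (thetaδ p) u) u := by
  obtain ⟨C, hC, hb⟩ := exists_abs_thetaTerm_le (thetaδ p)
  set R : ℝ := |u| + 1 with hR
  have hu : u ∈ Ioi (-R) := by
    simp only [mem_Ioi, hR]
    have := neg_abs_le u
    linarith
  have hs := (summable_exp_neg_mul_sq (c := π / 4 * exp (-R)) (by positivity)).mul_left C
  unfold thetaSeries
  refine hasDerivAt_tsum_of_isPreconnected hs isOpen_Ioi isPreconnected_Ioi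
    (fun n y _ => hasDerivAt_thetaTerm p n y) (fun n y hy => ?_) hu (summable_thetaTerm p u) hu
  rw [Real.norm_eq_abs]
  calc |thetaTerm (thetaδ p) n y|
      ≤ C * exp (-(π / 4 * exp (-R) * ((n : ℝ) + 1) ^ 2)) * thetaMajorant y :=
        hb R n y (le_of_lt hy)
    _ ≤ C * exp (-(π / 4 * exp (-R) * ((n : ℝ) + 1) ^ 2)) * 1 := by
        gcongr; exact thetaMajorant_le_one y
    _ = C * exp (-(π / 4 * exp (-R) * ((n : ℝ) + 1) ^ 2)) := mul_one _

/-- `deriv S_p = S_{δ p}`. [folklore] -/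
theorem deriv_thetaSeries (p : ℝ[X]) : deriv (thetaSeries p) = thetaSeries (thetaδ p) :=
  funext fun u => (hasDerivAt_thetaSeries p u).deriv

/-- `S_p` is differentiable. [folklore] -/
theorem differentiable_thetaSeries (p : ℝ[X]) : Differentiable ℝ (thetaSeries p) :=
  fun u => (hasDerivAt_thetaSeries p u).differentiableAt

/-- `S_p` is continuous. [folklore] -/
theorem continuous_thetaSeries (p : ℝ[X]) : Continuous (thetaSeries p) :=
  (differentiable_thetaSeries p).continuous

/-- Uniform bound `|S_p(u)| ≤ C M(u)` on `u ≥ −R`. [folklore] -/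
theorem exists_abs_thetaSeries_le (p : ℝ[X]) (R : ℝ) :
    ∃ C, 0 ≤ C ∧ ∀ u, -R ≤ u → |thetaSeries p u| ≤ C * thetaMajorant u := by
  obtain ⟨C, hC, hb⟩ := exists_abs_thetaTerm_le p
  have hs := summable_exp_neg_mul_sq (c := π / 4 * exp (-R)) (by positivity)
  refine ⟨C * ∑' n : ℕ, exp (-(π / 4 * exp (-R) * ((n : ℝ) + 1) ^ 2)), by positivity,
    fun u hu => ?_⟩
  have := tsum_of_norm_bounded ((hs.hasSum.mul_left C).mul_right (thetaMajorant u))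
    (f := fun n => thetaTerm p n u) (fun n => by rw [Real.norm_eq_abs]; exact hb R n u hu)
  rw [Real.norm_eq_abs] at this
  simpa [thetaSeries, mul_assoc] using this

/-- `S_p` is integrable on `(0, ∞)`. [folklore] -/
theorem integrableOn_thetaSeries (p : ℝ[X]) : IntegrableOn (thetaSeries p) (Ioi 0) := by
  obtain ⟨C, hC, hb⟩ := exists_abs_thetaSeries_le p 0
  have hπ : 0 < (π - 1) / 4 := by linarith [two_le_pi]
  have hg : IntegrableOn (fun u : ℝ => C * exp (-(π / 4)) * exp (-((π - 1) / 4) * u)) (Ioi 0) :=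
    (exp_neg_integrableOn_Ioi 0 hπ).const_mul _
  refine hg.mono' (continuous_thetaSeries p).aestronglyMeasurable
    (ae_restrict_of_forall_mem measurableSet_Ioi fun u hu => ?_)
  rw [Real.norm_eq_abs]
  calc |thetaSeries p u| ≤ C * thetaMajorant u := hb u (by rw [neg_zero]; exact le_of_lt hu)
    _ ≤ C * (exp (-(π / 4)) * exp (-((π - 1) / 4) * u)) := by
        gcongr; exact thetaMajorant_le_exp u
    _ = C * exp (-(π / 4)) * exp (-((π - 1) / 4) * u) := by ring

/-- `S_p(u) → 0` as `u → +∞`. [folklore] -/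
theorem tendsto_thetaSeries_atTop (p : ℝ[X]) : Tendsto (thetaSeries p) atTop (𝓝 0) := by
  obtain ⟨C, hC, hb⟩ := exists_abs_thetaSeries_le p 0
  have hπ : -((π - 1) / 4) < 0 := by linarith [two_le_pi]
  have hlim : Tendsto (fun u : ℝ => C * (exp (-(π / 4)) * exp (-((π - 1) / 4) * u))) atTop
      (𝓝 (C * (exp (-(π / 4)) * 0))) := by
    refine tendsto_const_nhds.mul (tendsto_const_nhds.mul ?_)
    exact tendsto_exp_comp_nhds_zero.mpr (tendsto_id.const_mul_atTop_of_neg hπ)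
  rw [mul_zero, mul_zero] at hlim
  refine squeeze_zero_norm' ?_ hlim
  filter_upwards [eventually_ge_atTop 0] with u hu
  rw [Real.norm_eq_abs]
  calc |thetaSeries p u| ≤ C * thetaMajorant u := hb u (by rw [neg_zero]; exact hu)
    _ ≤ C * (exp (-(π / 4)) * exp (-((π - 1) / 4) * u)) := by
        gcongr; exact thetaMajorant_le_exp u

/-- Linear combinations: if `a p + b q = r` pointwise then `a S_p + b S_q = S_r`. [folklore] -/
theorem thetaSeries_lin (a b : ℝ) (p q r : ℝ[X])
    (h : ∀ y, a * p.eval y + b * q.eval y = r.eval y) (u : ℝ) :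
    a * thetaSeries p u + b * thetaSeries q u = thetaSeries r u := by
  unfold thetaSeries
  rw [← tsum_mul_left, ← tsum_mul_left, ← Summable.tsum_add ((summable_thetaTerm p u).mul_left a)
    ((summable_thetaTerm q u).mul_left b)]
  refine tsum_congr fun n => ?_
  simp only [thetaTerm, ← h]
  ring

/-! ## The link with Jacobi's theta function -/

/-- `h(u) := S_2(u) = e^{u/4}(θ(eᵘ) − 1)`, `θ(x) = Σ_{n ∈ ℤ} e^{−π n² x}`. [cite: LagariasMontague2011, Lemma 3.1] -/
def thetaH : ℝ → ℝ := thetaSeries (C 2)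

/-- `h(u) = e^{u/4}(θ(eᵘ) − 1)` with `θ = HurwitzZeta.evenKernel 0` (Mathlib's Jacobi theta on
`(0,∞)`). [cite: LagariasMontague2011, Lemma 3.1] -/
theorem thetaH_eq (u : ℝ) : thetaH u = exp (u / 4) * (evenKernel 0 (exp u) - 1) := by
  have hs := hasSum_nat_cosKernel₀ 0 (exp_pos u)
  simp only [mul_zero, zero_mul, Real.cos_zero, mul_one] at hs
  have h0 : ((0 : ℝ) : UnitAddCircle) = 0 := rfl
  rw [h0] at hs
  rw [evenKernel_eq_cosKernel_of_zero, ← hs.tsum_eq, ← tsum_mul_left]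
  unfold thetaH thetaSeries
  refine tsum_congr fun n => ?_
  simp only [thetaTerm, thetaWeight, eval_C]
  rw [sub_eq_add_neg, exp_add]
  have : -(π * ((n : ℝ) + 1) ^ 2 * exp u) = -π * ((n : ℝ) + 1) ^ 2 * exp u := by ring
  rw [this]
  ring

/-- Jacobi's transformation law in exponential coordinates: `θ(e^{−u}) = e^{u/2} θ(eᵘ)`
(`θ(1/x) = √x θ(x)`, Mathlib's `evenKernel_functional_equation`). [folklore] -/
theorem evenKernel_zero_exp_neg (u : ℝ) :
    evenKernel 0 (exp (-u)) = exp (u / 2) * evenKernel 0 (exp u) := by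
  rw [evenKernel_functional_equation, ← evenKernel_eq_cosKernel_of_zero]
  have h1 : 1 / exp (-u) = exp u := by rw [exp_neg, one_div, inv_inv]
  have h2 : (exp (-u)) ^ (1 / 2 : ℝ) = exp (-(u / 2)) := by
    rw [← exp_mul]; congr 1; ring
  rw [h1, h2, exp_neg, one_div, inv_inv]

/-- `G(u) := e^{u/4} θ(eᵘ)`. [cite: LagariasMontague2011, Lemma 3.1 (1)] -/
def thetaG (u : ℝ) : ℝ := exp (u / 4) * evenKernel 0 (exp u)

/-- `G = h + e^{u/4}`. [folklore] -/
theorem thetaG_eq (u : ℝ) : thetaG u = thetaH u + exp (u / 4) := by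
  rw [thetaH_eq, thetaG]; ring

/-- `G` is even: `G(−u) = G(u)` — the theta functional equation `θ(1/x) = √x θ(x)`.
[cite: LagariasMontague2011, Lemma 3.1 (2)] -/
theorem thetaG_neg (u : ℝ) : thetaG (-u) = thetaG u := by
  unfold thetaG
  rw [evenKernel_zero_exp_neg, ← mul_assoc, ← exp_add]
  congr 2
  ring

/-- `G' = h' + e^{u/4}/4` with `h' = S_{δ2}`. [folklore] -/
theorem hasDerivAt_thetaG (u : ℝ) :
    HasDerivAt thetaG (thetaSeries (thetaδ (C 2)) u + exp (u / 4) / 4) u := by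
  have hG : thetaG = fun u => thetaH u + exp (u / 4) := funext thetaG_eq
  rw [hG]
  have h1 : HasDerivAt thetaH (thetaSeries (thetaδ (C 2)) u) u := hasDerivAt_thetaSeries (C 2) u
  have h2 : HasDerivAt (fun u => exp (u / 4)) (exp (u / 4) * (1 / 4)) u :=
    ((hasDerivAt_id u).div_const 4).exp
  refine (h1.add h2).congr_deriv ?_
  ring

/-- `deriv G = h' + e^{u/4}/4`. [folklore] -/
theorem deriv_thetaG : deriv thetaG = fun u => thetaSeries (thetaδ (C 2)) u + exp (u / 4) / 4 :=
  funext fun u => (hasDerivAt_thetaG u).deriv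

/-- `deriv (deriv G) = h'' + e^{u/4}/16` with `h'' = S_{δδ2}`. [folklore] -/
theorem deriv_deriv_thetaG :
    deriv (deriv thetaG) = fun u => thetaSeries (thetaδ (thetaδ (C 2))) u + exp (u / 4) / 16 := by
  rw [deriv_thetaG]
  funext u
  have h1 := hasDerivAt_thetaSeries (thetaδ (C 2)) u
  have h2 : HasDerivAt (fun u => exp (u / 4) / 4) (exp (u / 4) * (1 / 4) / 4) u :=
    ((hasDerivAt_id u).div_const 4).exp.div_const 4
  have h3 : HasDerivAt (fun u => thetaSeries (thetaδ (C 2)) u + exp (u / 4) / 4)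
      (thetaSeries (thetaδ (thetaδ (C 2))) u + exp (u / 4) * (1 / 4) / 4) u := h1.add h2
  rw [h3.deriv]
  ring

/-- **`h'(0) = −1/4`**: since `G` is even, `G'(0) = 0`. This is the boundary term producing the
constant `1/2 = ξ(0)·…` in Riemann's integration by parts. [cite: LagariasMontague2011, Lemma 3.1] -/
theorem thetaSeries_δ_two_zero : thetaSeries (thetaδ (C 2)) 0 = -(1 / 4) := by
  have h1 := hasDerivAt_thetaG 0
  have h2 : HasDerivAt (thetaG ∘ Neg.neg)
      ((thetaSeries (thetaδ (C 2)) (-0) + exp (-0 / 4) / 4) * -1) 0 :=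
    (hasDerivAt_thetaG (-0)).comp 0 (hasDerivAt_neg 0)
  have hfun : thetaG ∘ Neg.neg = thetaG := funext fun u => thetaG_neg u
  rw [hfun] at h2
  have := h1.unique h2
  simp only [neg_zero, zero_div, exp_zero] at this
  linarith

/-! ## Riemann's kernel `Ψ` -/

/-- The polynomial `2X² − 3X` of Riemann's kernel. [cite: LagariasMontague2011, eq. (3.4)] -/
def psiPoly : ℝ[X] := C 2 * X ^ 2 - C 3 * X

/-- `(2X² − 3X)(y) = 2y² − 3y`. [folklore] -/
@[simp] theorem eval_psiPoly (y : ℝ) : psiPoly.eval y = 2 * y ^ 2 - 3 * y := by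
  simp [psiPoly]

/-- **Riemann's kernel** `Ψ(u) := Σ_{n≥1} (2π²n⁴e^{2u} − 3πn²eᵘ) exp(u/4 − πn²eᵘ)`; in the notation
of Lagarias–Montague, `Ψ(u) = ½ Φ(u/2)` with `Φ(v) = Σ (4π²n⁴e^{9v/2} − 6πn²e^{5v/2}) e^{−πn²e^{2v}}`.
[cite: LagariasMontague2011, eq. (3.4)] -/
def Psi : ℝ → ℝ := thetaSeries psiPoly

/-- `Ψ = h'' − h/16`. [cite: LagariasMontague2011, Lemma 3.1 (1)] -/
theorem Psi_eq_thetaH (u : ℝ) :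
    Psi u = thetaSeries (thetaδ (thetaδ (C 2))) u - thetaH u / 16 := by
  have key : ∀ y : ℝ, 1 * (thetaδ (thetaδ (C 2))).eval y + -(1 / 16) * (C 2 : ℝ[X]).eval y =
      psiPoly.eval y := fun y => by
    simp [thetaδ]
    ring
  have := thetaSeries_lin 1 (-(1 / 16)) _ _ _ key u
  show thetaSeries psiPoly u = _ - thetaSeries (C 2) u / 16
  linarith

/-- `Ψ = G'' − G/16` (`(e^{u/4})'' = e^{u/4}/16`). [cite: LagariasMontague2011, Lemma 3.1 (1)] -/
theorem Psi_eq_thetaG (u : ℝ) : Psi u = deriv (deriv thetaG) u - thetaG u / 16 := by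
  rw [deriv_deriv_thetaG, thetaG_eq, Psi_eq_thetaH]
  ring

/-- `Ψ` is even. [cite: LagariasMontague2011, Lemma 3.1 (2)] -/
theorem Psi_neg (u : ℝ) : Psi (-u) = Psi u := by
  have hfun : (fun x => thetaG (-x)) = thetaG := funext thetaG_neg
  have e1 : ∀ x, deriv thetaG x = -deriv thetaG (-x) := fun x => by
    rw [← deriv_comp_neg, hfun]
  have e2 : deriv (deriv thetaG) (-u) = deriv (deriv thetaG) u := by
    have hd : deriv thetaG = fun x => -deriv thetaG (-x) := funext e1
    conv_rhs => rw [hd]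
    rw [deriv.fun_neg, deriv_comp_neg, neg_neg]
  rw [Psi_eq_thetaG, Psi_eq_thetaG, e2, thetaG_neg]

/-- `Ψ'  := S_{δ(2X²−3X)}` is `deriv Ψ`. [folklore] -/
theorem deriv_Psi : deriv Psi = thetaSeries (thetaδ psiPoly) := deriv_thetaSeries psiPoly

/-- `Ψ'` is odd. [folklore] -/
theorem thetaSeries_δ_psiPoly_neg (u : ℝ) :
    thetaSeries (thetaδ psiPoly) (-u) = -thetaSeries (thetaδ psiPoly) u := by
  have hfun : (fun x => Psi (-x)) = Psi := funext Psi_neg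
  have := deriv_comp_neg (f := Psi) (x := -u)
  rw [hfun, neg_neg, deriv_Psi] at this
  linarith

/-- `Ψ''` is even. [folklore] -/
theorem thetaSeries_δδ_psiPoly_neg (u : ℝ) :
    thetaSeries (thetaδ (thetaδ psiPoly)) (-u) = thetaSeries (thetaδ (thetaδ psiPoly)) u := by
  have hfun : (fun x => thetaSeries (thetaδ psiPoly) (-x)) = fun x => -thetaSeries (thetaδ psiPoly) x :=
    funext thetaSeries_δ_psiPoly_neg
  have := deriv_comp_neg (f := thetaSeries (thetaδ psiPoly)) (x := -u)
  rw [hfun, neg_neg, deriv.fun_neg, deriv_thetaSeries] at this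
  linarith

/-- `Ψ(0) = Σ_{n≥1} (2π²n⁴ − 3πn²) e^{−πn²}` (`= Φ(0)/2 ≈ 0.4467`). [cite: LagariasMontague2011, Lemma 3.1 (5)] -/
theorem Psi_zero : Psi 0 = ∑' n : ℕ,
    (2 * π ^ 2 * ((n : ℝ) + 1) ^ 4 - 3 * π * ((n : ℝ) + 1) ^ 2) * exp (-(π * ((n : ℝ) + 1) ^ 2)) := by
  unfold Psi thetaSeries
  refine tsum_congr fun n => ?_
  simp only [thetaTerm, thetaWeight, eval_psiPoly, exp_zero, mul_one, zero_div, zero_sub]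
  ring

/-- The terms of `Ψ(0)` are positive (`2π > 3`). [folklore] -/
theorem thetaTerm_psiPoly_zero_pos (n : ℕ) : 0 < thetaTerm psiPoly n 0 := by
  have hw := pi_le_thetaWeight n
  simp only [thetaTerm, eval_psiPoly, exp_zero, mul_one]
  refine mul_pos ?_ (exp_pos _)
  nlinarith [two_le_pi]

/-- `Ψ(0) > 0`. [cite: LagariasMontague2011, Thm. 2.1 (1)] -/
theorem Psi_zero_pos : 0 < Psi 0 :=
  (summable_thetaTerm psiPoly 0).tsum_pos (fun n => (thetaTerm_psiPoly_zero_pos n).le) 0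
    (thetaTerm_psiPoly_zero_pos 0)

/-! ## Integrability on `ℝ` from parity -/

/-- A continuous function integrable on `(0,∞)` with `‖f(−u)‖ = ‖f(u)‖` is integrable on `ℝ`.
[folklore] -/
theorem integrable_of_norm_neg {E : Type*} [NormedAddCommGroup E] {f : ℝ → E} (hc : Continuous f)
    (hf : IntegrableOn f (Ioi 0)) (h : ∀ u, ‖f (-u)‖ = ‖f u‖) : Integrable f := by
  have hIci : IntegrableOn f (Ici 0) := (integrableOn_Ici_iff_integrableOn_Ioi).mpr hf
  have hIic : IntegrableOn f (Iic 0) := by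
    rw [← Measure.map_neg_eq_self (volume : Measure ℝ)]
    let m : MeasurableEmbedding fun x : ℝ => -x := (Homeomorph.neg ℝ).measurableEmbedding
    rw [m.integrableOn_map_iff]
    simp only [Function.comp_def, neg_preimage, neg_Iic, neg_zero]
    refine Integrable.mono hIci (hc.comp continuous_neg).aestronglyMeasurable
      (ae_of_all _ fun x => ?_)
    rw [h x]
  have := hIic.union hf
  rwa [Iic_union_Ioi, integrableOn_univ] at this

/-- If `F` is continuous and integrable on `(0,∞)` then `u ↦ F |u|` is integrable on `ℝ`.
[folklore] -/
theorem integrable_comp_abs {E : Type*} [NormedAddCommGroup E] {F : ℝ → E} (hc : Continuous F)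
    (hF : IntegrableOn F (Ioi 0)) : Integrable fun u => F |u| := by
  refine integrable_of_norm_neg (hc.comp continuous_abs) ?_ fun u => by rw [abs_neg]
  exact hF.congr_fun (fun u hu => by rw [abs_of_pos (mem_Ioi.mp hu)]) measurableSet_Ioi

/-- `Ψ` is integrable on `ℝ`. [folklore] -/
theorem integrable_Psi : Integrable Psi :=
  integrable_of_norm_neg (continuous_thetaSeries _) (integrableOn_thetaSeries _)
    fun u => by rw [Psi_neg]

/-- `Ψ'` is integrable on `ℝ`. [folklore] -/
theorem integrable_deriv_Psi : Integrable (thetaSeries (thetaδ psiPoly)) :=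
  integrable_of_norm_neg (continuous_thetaSeries _) (integrableOn_thetaSeries _)
    fun u => by rw [thetaSeries_δ_psiPoly_neg, norm_neg]

/-- `Ψ''` is integrable on `ℝ`. [folklore] -/
theorem integrable_deriv_deriv_Psi : Integrable (thetaSeries (thetaδ (thetaδ psiPoly))) :=
  integrable_of_norm_neg (continuous_thetaSeries _) (integrableOn_thetaSeries _)
    fun u => by rw [thetaSeries_δδ_psiPoly_neg]

/-! ## Part II — the Mellin side, Riemann's integrations by parts, Fourier inversion -/

open Complex
open scoped FourierTransform

/-! ## Unfolding Mathlib's `Λ₀` on the critical line -/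

/-- The Mellin-side function `g(u) := e^{−u/4} f_modif(e^{−u})` of Mathlib's construction of `Λ₀`
(`f_modif` the modified theta kernel of `hurwitzEvenFEPair 0`). [folklore] -/
def mellinSide (u : ℝ) : ℂ :=
  (rexp (-(1 / 4) * u) : ℝ) • (hurwitzEvenFEPair 0).f_modif (rexp (-u))

/-- `Λ₀(1/2 + it) = 𝓕 g (t/4π) / 2` — Mathlib's definition of `completedRiemannZeta₀` as a Mellin
transform, rewritten as a Fourier transform (`mellin_eq_fourier`). [folklore] -/
theorem completedRiemannZeta₀_criticalLine (t : ℝ) :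
    completedRiemannZeta₀ (1 / 2 + t * I) = 𝓕 mellinSide (t / (4 * π)) / 2 := by
  have hre : ((1 / 2 + (t : ℂ) * I) / 2).re = 1 / 4 := by simp; norm_num
  have him : ((1 / 2 + (t : ℂ) * I) / 2).im = t / 2 := by simp
  rw [completedRiemannZeta₀, completedHurwitzZetaEven₀, WeakFEPair.Λ₀, mellin_eq_fourier, hre, him]
  have h4 : t / 2 / (2 * π) = t / (4 * π) := by
    rw [div_div]; ring_nf
  rw [h4]
  rfl

/-- `f_modif(x) = θ(x) − 1` for `x > 1`. [folklore] -/
theorem f_modif_of_one_lt {x : ℝ} (hx : 1 < x) :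
    (hurwitzEvenFEPair 0).f_modif x = (evenKernel 0 x : ℂ) - 1 := by
  rw [WeakFEPair.f_modif, Pi.add_apply, indicator_of_mem (mem_Ioi.mpr hx),
    indicator_of_notMem (fun h => absurd (mem_Ioo.mp h).2 (not_lt.mpr hx.le)), add_zero]
  simp [hurwitzEvenFEPair]

/-- `f_modif(x) = θ(x) − x^{−1/2}` for `0 < x < 1`. [folklore] -/
theorem f_modif_of_lt_one {x : ℝ} (hx0 : 0 < x) (hx : x < 1) :
    (hurwitzEvenFEPair 0).f_modif x = (evenKernel 0 x : ℂ) - ((x ^ (-(1 / 2 : ℝ)) : ℝ) : ℂ) := by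
  rw [WeakFEPair.f_modif, Pi.add_apply, indicator_of_notMem (fun h => ?_),
    indicator_of_mem (mem_Ioo.mpr ⟨hx0, hx⟩), zero_add]
  · simp [hurwitzEvenFEPair]
  · exact absurd (mem_Ioi.mp h) (not_lt.mpr hx.le)

/-- `g(u) = h(|u|)` for `u ≠ 0`, where `h(u) = e^{u/4}(θ(eᵘ) − 1)`: for `u < 0` directly, for
`u > 0` through Jacobi's `θ(e^{−u}) = e^{u/2}θ(eᵘ)`. [folklore] -/
theorem mellinSide_eq_thetaH {u : ℝ} (hu : u ≠ 0) : mellinSide u = (thetaH |u| : ℂ) := by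
  rcases lt_or_gt_of_ne hu with h | h
  · have h1 : 1 < rexp (-u) := by rw [one_lt_exp_iff]; linarith
    have key : rexp (-(1 / 4) * u) * (evenKernel 0 (rexp (-u)) - 1) = thetaH |u| := by
      rw [abs_of_neg h, thetaH_eq]
      congr 2
      ring
    rw [mellinSide, f_modif_of_one_lt h1, Complex.real_smul, ← key]
    push_cast
    ring
  · have h1 : rexp (-u) < 1 := by rw [exp_lt_one_iff]; linarith
    have h2 : (rexp (-u)) ^ (-(1 / 2 : ℝ)) = rexp (u / 2) := by
      rw [← exp_mul]; congr 1; ring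
    have key : rexp (-(1 / 4) * u) * (evenKernel 0 (rexp (-u)) - (rexp (-u)) ^ (-(1 / 2 : ℝ))) =
        thetaH |u| := by
      rw [abs_of_pos h, thetaH_eq, evenKernel_zero_exp_neg, h2, ← mul_sub_one, ← mul_assoc,
        ← Real.exp_add]
      congr 2
      ring
    rw [mellinSide, f_modif_of_lt_one (exp_pos _) h1, Complex.real_smul, ← key]
    push_cast
    ring

/-- `g = h ∘ |·|` almost everywhere. [folklore] -/
theorem mellinSide_ae_eq : mellinSide =ᵐ[volume] fun u => (thetaH |u| : ℂ) := by
  have : ∀ᵐ u : ℝ, u ≠ 0 := by simp [ae_iff]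
  filter_upwards [this] with u hu using mellinSide_eq_thetaH hu

/-! ## Folding integrals over `ℝ` onto `(0, ∞)` -/

/-- `∫_ℝ F(|v|) ω(v) dv = ∫_{(0,∞)} F(v)(ω(v) + ω(−v)) dv` for `F` integrable on `(0,∞)` and a
bounded continuous weight `ω`. [folklore] -/
theorem integral_comp_abs_mul {F : ℝ → ℂ} (hFc : Continuous F) (hF : IntegrableOn F (Ioi 0))
    {ω : ℝ → ℂ} (hωc : Continuous ω) (hωb : ∀ v, ‖ω v‖ ≤ 1) :
    ∫ v, F |v| * ω v = ∫ v in Ioi 0, F v * (ω v + ω (-v)) := by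
  have hint : Integrable fun v => F |v| * ω v :=
    (integrable_comp_abs hFc hF).mul_bdd hωc.aestronglyMeasurable (ae_of_all _ hωb)
  rw [← intervalIntegral.integral_Iic_add_Ioi (b := (0 : ℝ)) hint.integrableOn hint.integrableOn]
  have h1 : ∫ v in Iic 0, F |v| * ω v = ∫ v in Ioi 0, F v * ω (-v) := by
    have := integral_comp_neg_Ioi 0 (fun v => F |v| * ω v)
    rw [neg_zero] at this
    rw [← this]
    refine setIntegral_congr_fun measurableSet_Ioi fun v hv => ?_
    simp [abs_of_pos (mem_Ioi.mp hv)]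
  have h2 : ∫ v in Ioi 0, F |v| * ω v = ∫ v in Ioi 0, F v * ω v :=
    setIntegral_congr_fun measurableSet_Ioi fun v hv => by rw [abs_of_pos (mem_Ioi.mp hv)]
  rw [h1, h2, ← integral_add]
  · refine integral_congr_ae (ae_of_all _ fun v => ?_)
    ring
  · exact hF.mul_bdd (hωc.comp continuous_neg).aestronglyMeasurable (ae_of_all _ fun v => hωb _)
  · exact hF.mul_bdd hωc.aestronglyMeasurable (ae_of_all _ fun v => hωb _)

/-- `∫_ℝ F = 2 ∫_{(0,∞)} F` for an even integrable `F`. [folklore] -/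
theorem integral_eq_two_mul_Ioi_of_even {F : ℝ → ℂ} (hF : Integrable F) (h : ∀ t, F (-t) = F t) :
    ∫ t, F t = 2 * ∫ t in Ioi 0, F t := by
  rw [← intervalIntegral.integral_Iic_add_Ioi (b := (0 : ℝ)) hF.integrableOn hF.integrableOn]
  have h1 : ∫ t in Iic 0, F t = ∫ t in Ioi 0, F t := by
    have := integral_comp_neg_Ioi 0 F
    rw [neg_zero] at this
    rw [← this]
    simp only [h]
  rw [h1]
  ring

/-! ## The oscillatory weight `c_w(u) = e^{2πiuw} + e^{−2πiuw}` -/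

/-- `u ↦ e^{ku}` for a complex frequency `k`. [folklore] -/
def expLin (k : ℂ) (u : ℝ) : ℂ := cexp (k * u)

/-- `d/du e^{ku} = k e^{ku}`. [folklore] -/
theorem hasDerivAt_expLin (k : ℂ) (u : ℝ) : HasDerivAt (expLin k) (k * expLin k u) u := by
  unfold expLin
  have h : HasDerivAt (fun u : ℝ => k * (u : ℂ)) (k * 1) u :=
    (hasDerivAt_id (u : ℂ)).comp_ofReal.const_mul k |>.congr_deriv (by simp)
  convert (h.cexp) using 1
  ring

/-- `|e^{iθ}| = 1`: `‖expLin (i a) u‖ = 1` for real `a`. [folklore] -/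
theorem norm_expLin_I (a u : ℝ) : ‖expLin (a * I) u‖ = 1 := by
  rw [expLin, Complex.norm_exp]
  simp

/-- The even weight `c_a(u) := e^{iau} + e^{−iau}` (`= 2 cos(au)`). [folklore] -/
def cosW (a : ℝ) (u : ℝ) : ℂ := expLin (a * I) u + expLin (-(a * I)) u

/-- `c_a'(u) = ia(e^{iau} − e^{−iau})`. [folklore] -/
def cosW' (a : ℝ) (u : ℝ) : ℂ := a * I * expLin (a * I) u - a * I * expLin (-(a * I)) u

/-- `c_a' ` is the derivative of `c_a`. [folklore] -/
theorem hasDerivAt_cosW (a u : ℝ) : HasDerivAt (cosW a) (cosW' a u) u := by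
  unfold cosW cosW'
  refine ((hasDerivAt_expLin _ u).add (hasDerivAt_expLin _ u)).congr_deriv ?_
  ring

/-- `(c_a')' = −a² c_a`. [folklore] -/
theorem hasDerivAt_cosW' (a u : ℝ) : HasDerivAt (cosW' a) (-((a : ℂ) ^ 2 * cosW a u)) u := by
  unfold cosW cosW'
  refine (((hasDerivAt_expLin _ u).const_mul _).sub ((hasDerivAt_expLin _ u).const_mul _)).congr_deriv ?_
  have hI : I * I = -1 := I_mul_I
  linear_combination (a : ℂ) ^ 2 * (expLin (a * I) u + expLin (-(a * I)) u) * hI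

/-- `‖c_a(u)‖ ≤ 2`. [folklore] -/
theorem norm_cosW_le (a u : ℝ) : ‖cosW a u‖ ≤ 2 := by
  unfold cosW
  refine (norm_add_le _ _).trans ?_
  have h1 := norm_expLin_I a u
  have h2 : ‖expLin (-(a * I)) u‖ = 1 := by
    have := norm_expLin_I (-a) u; push_cast at this; simpa [neg_mul] using this
  linarith

/-- `‖c_a'(u)‖ ≤ 2|a|`. [folklore] -/
theorem norm_cosW'_le (a u : ℝ) : ‖cosW' a u‖ ≤ 2 * |a| := by
  unfold cosW'
  refine (norm_sub_le _ _).trans ?_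
  have h1 := norm_expLin_I a u
  have h2 : ‖expLin (-(a * I)) u‖ = 1 := by
    have := norm_expLin_I (-a) u; push_cast at this; simpa [neg_mul] using this
  simp only [norm_mul, Complex.norm_real, Complex.norm_I, h1, h2, Real.norm_eq_abs]
  linarith

/-- `c_a(0) = 2`. [folklore] -/
theorem cosW_zero (a : ℝ) : cosW a 0 = 2 := by
  simp [cosW, expLin]; norm_num

/-- `c_a'(0) = 0`. [folklore] -/
theorem cosW'_zero (a : ℝ) : cosW' a 0 = 0 := by
  simp [cosW', expLin]

/-- `c` and `c'` are continuous. [folklore] -/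
theorem continuous_cosW (a : ℝ) : Continuous (cosW a) :=
  continuous_iff_continuousAt.mpr fun u => (hasDerivAt_cosW a u).continuousAt

/-- `c'` is continuous. [folklore] -/
theorem continuous_cosW' (a : ℝ) : Continuous (cosW' a) :=
  continuous_iff_continuousAt.mpr fun u => (hasDerivAt_cosW' a u).continuousAt

/-! ## Products of theta series with bounded weights -/

/-- `S_p · ω` is integrable on `(0,∞)` for a bounded continuous weight `ω`. [folklore] -/
theorem integrableOn_thetaSeries_mul (p : ℝ[X]) {ω : ℝ → ℂ} (hωc : Continuous ω) {B : ℝ}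
    (hωb : ∀ v, ‖ω v‖ ≤ B) :
    IntegrableOn (fun u => (thetaSeries p u : ℂ) * ω u) (Ioi 0) :=
  (integrableOn_thetaSeries p).ofReal.mul_bdd hωc.aestronglyMeasurable (ae_of_all _ hωb)

/-- `S_p(u) ω(u) → 0` as `u → ∞` for a bounded weight `ω`. [folklore] -/
theorem tendsto_thetaSeries_mul_atTop (p : ℝ[X]) {ω : ℝ → ℂ} {B : ℝ} (hωb : ∀ v, ‖ω v‖ ≤ B) :
    Tendsto (fun u => (thetaSeries p u : ℂ) * ω u) atTop (𝓝 0) := by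
  have hB : 0 ≤ B := (norm_nonneg _).trans (hωb 0)
  refine squeeze_zero_norm (fun u => ?_)
    (by simpa using ((tendsto_thetaSeries_atTop p).abs.mul_const B))
  rw [norm_mul, Complex.norm_real, Real.norm_eq_abs]
  exact mul_le_mul_of_nonneg_left (hωb u) (abs_nonneg _)

/-- Continuity of the complexified theta series. [folklore] -/
theorem continuous_thetaSeries_ofReal (p : ℝ[X]) : Continuous fun u => (thetaSeries p u : ℂ) :=
  continuous_ofReal.comp (continuous_thetaSeries p)

/-! ## Riemann's two integrations by parts -/

/-- First integration by parts: `∫₀^∞ h (c_a)'' = −∫₀^∞ h' c_a'` (boundary terms vanish since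
`c_a'(0) = 0` and `h(∞) = 0`). [cite: LagariasMontague2011, Lemma 3.1] -/
theorem integral_thetaH_mul_cosW'' (a : ℝ) :
    ∫ u in Ioi 0, (thetaH u : ℂ) * (-((a : ℂ) ^ 2 * cosW a u)) =
      -∫ u in Ioi 0, (thetaSeries (thetaδ (C 2)) u : ℂ) * cosW' a u := by
  have hb : ∀ v, ‖-((a : ℂ) ^ 2 * cosW a v)‖ ≤ a ^ 2 * 2 := fun v => by
    rw [norm_neg, norm_mul, norm_pow, Complex.norm_real, Real.norm_eq_abs, sq_abs]
    exact mul_le_mul_of_nonneg_left (norm_cosW_le a v) (sq_nonneg a)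
  have hcont : Continuous fun u => -((a : ℂ) ^ 2 * cosW a u) :=
    (continuous_const.mul (continuous_cosW a)).neg
  have hi : IntegrableOn (fun u => (thetaH u : ℂ) * -((a : ℂ) ^ 2 * cosW a u)) (Ioi 0) :=
    integrableOn_thetaSeries_mul (C 2) hcont hb
  have hi' : IntegrableOn (fun u => (thetaSeries (thetaδ (C 2)) u : ℂ) * cosW' a u) (Ioi 0) :=
    integrableOn_thetaSeries_mul _ (continuous_cosW' a) (norm_cosW'_le a)
  have h := integral_Ioi_mul_deriv_eq_deriv_mul (a := 0) (u := fun u => (thetaH u : ℂ))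
    (u' := fun u => (thetaSeries (thetaδ (C 2)) u : ℂ)) (v := cosW' a)
    (v' := fun u => -((a : ℂ) ^ 2 * cosW a u)) (a' := (thetaH 0 : ℂ) * cosW' a 0) (b' := 0)
    (fun x _ => (hasDerivAt_thetaSeries (C 2) x).ofReal_comp) (fun x _ => hasDerivAt_cosW' a x)
    hi hi'
    ((((continuous_thetaSeries_ofReal (C 2)).mul (continuous_cosW' a)).tendsto 0).mono_left
      nhdsWithin_le_nhds)
    (tendsto_thetaSeries_mul_atTop (C 2) (norm_cosW'_le a))
  rw [h, cosW'_zero, mul_zero, sub_zero, zero_sub]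

/-- Second integration by parts: `∫₀^∞ h' c_a' = −h'(0)c_a(0) − ∫₀^∞ h'' c_a = 1/2 − ∫₀^∞ h'' c_a`
(`h'(0) = −1/4`, `c_a(0) = 2`). [cite: LagariasMontague2011, Lemma 3.1] -/
theorem integral_thetaH'_mul_cosW' (a : ℝ) :
    ∫ u in Ioi 0, (thetaSeries (thetaδ (C 2)) u : ℂ) * cosW' a u =
      1 / 2 - ∫ u in Ioi 0, (thetaSeries (thetaδ (thetaδ (C 2))) u : ℂ) * cosW a u := by
  have h := integral_Ioi_mul_deriv_eq_deriv_mul (a := 0)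
    (u := fun u => (thetaSeries (thetaδ (C 2)) u : ℂ))
    (u' := fun u => (thetaSeries (thetaδ (thetaδ (C 2))) u : ℂ)) (v := cosW a) (v' := cosW' a)
    (a' := (thetaSeries (thetaδ (C 2)) 0 : ℂ) * cosW a 0) (b' := 0)
    (fun x _ => (hasDerivAt_thetaSeries _ x).ofReal_comp) (fun x _ => hasDerivAt_cosW a x)
    (integrableOn_thetaSeries_mul _ (continuous_cosW' a) (norm_cosW'_le a))
    (integrableOn_thetaSeries_mul _ (continuous_cosW a) (norm_cosW_le a))
    ((((continuous_thetaSeries_ofReal _).mul (continuous_cosW a)).tendsto 0).mono_left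
      nhdsWithin_le_nhds)
    (tendsto_thetaSeries_mul_atTop _ (norm_cosW_le a))
  rw [h, thetaSeries_δ_two_zero, cosW_zero]
  push_cast
  ring

/-- **Riemann's identity** behind `Ξ(t) = 2∫₀^∞ Φ(u) cos(tu) du` (the passage from Titchmarsh
(10.1.1) to (10.1.2): integrate by parts twice, the boundary term being `4ψ′(1) + ψ(1) = −1/2`, here
`2h′(0) = −1/2`): for every real `a`, `∫₀^∞ Ψ c_a = 1/2 − (a² + 1/16) ∫₀^∞ h c_a`.
[cite: Titchmarsh1986, §10.1 eq. (10.1.2)] -/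
theorem integral_Psi_mul_cosW (a : ℝ) :
    ∫ u in Ioi 0, (Psi u : ℂ) * cosW a u =
      1 / 2 - ((a : ℂ) ^ 2 + 1 / 16) * ∫ u in Ioi 0, (thetaH u : ℂ) * cosW a u := by
  have e1 := integral_thetaH_mul_cosW'' a
  have e2 := integral_thetaH'_mul_cosW' a
  have i0 : IntegrableOn (fun u => (thetaH u : ℂ) * cosW a u) (Ioi 0) :=
    integrableOn_thetaSeries_mul (C 2) (continuous_cosW a) (norm_cosW_le a)
  have i2 := integrableOn_thetaSeries_mul (thetaδ (thetaδ (C 2))) (continuous_cosW a)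
    (norm_cosW_le a)
  have e3 : ∫ u in Ioi 0, (Psi u : ℂ) * cosW a u =
      (∫ u in Ioi 0, (thetaSeries (thetaδ (thetaδ (C 2))) u : ℂ) * cosW a u) -
        1 / 16 * ∫ u in Ioi 0, (thetaH u : ℂ) * cosW a u := by
    rw [← integral_const_mul, ← integral_sub i2 (i0.const_mul _)]
    refine setIntegral_congr_fun measurableSet_Ioi fun u _ => ?_
    rw [Psi_eq_thetaH]
    push_cast
    ring
  have e4 : ∫ u in Ioi 0, (thetaH u : ℂ) * -((a : ℂ) ^ 2 * cosW a u) =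
      -(a : ℂ) ^ 2 * ∫ u in Ioi 0, (thetaH u : ℂ) * cosW a u := by
    rw [← integral_const_mul]
    refine setIntegral_congr_fun measurableSet_Ioi fun u _ => ?_
    ring
  rw [e4] at e1
  linear_combination e3 + e2 - e1

/-! ## Riemann's formula as a Fourier transform -/

/-- `𝓕 g (w) = ∫₀^∞ h(v) c_{2πw}(v) dv`. [folklore] -/
theorem fourier_mellinSide (w : ℝ) :
    𝓕 mellinSide w = ∫ v in Ioi 0, (thetaH v : ℂ) * cosW (2 * π * w) v := by
  rw [Real.fourier_real_eq_integral_exp_smul]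
  have h1 : ∫ v : ℝ, cexp (↑(-2 * π * v * w) * I) • mellinSide v =
      ∫ v : ℝ, (thetaH |v| : ℂ) * cexp (↑(-2 * π * v * w) * I) := by
    refine integral_congr_ae ?_
    filter_upwards [mellinSide_ae_eq] with v hv
    rw [hv, smul_eq_mul, mul_comm]
  rw [h1]
  calc ∫ v : ℝ, (thetaH |v| : ℂ) * cexp (↑(-2 * π * v * w) * I)
      = ∫ v in Ioi 0, (thetaH v : ℂ) *
          (cexp (↑(-2 * π * v * w) * I) + cexp (↑(-2 * π * -v * w) * I)) :=
        integral_comp_abs_mul (F := fun v => (thetaH v : ℂ))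
          (ω := fun v : ℝ => cexp (↑(-2 * π * v * w) * I)) (continuous_thetaSeries_ofReal _)
          (integrableOn_thetaSeries _).ofReal (by fun_prop)
          (fun v => le_of_eq (Complex.norm_exp_ofReal_mul_I _))
    _ = ∫ v in Ioi 0, (thetaH v : ℂ) * cosW (2 * π * w) v := by
        refine setIntegral_congr_fun measurableSet_Ioi fun v _ => ?_
        rw [cosW, expLin, expLin, add_comm]
        congr 2 <;> (congr 1; push_cast; ring)

/-- `Ψ(|v|) = Ψ(v)`. [folklore] -/
theorem Psi_abs (v : ℝ) : Psi |v| = Psi v := by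
  rcases le_or_gt 0 v with h | h
  · rw [abs_of_nonneg h]
  · rw [abs_of_neg h, Psi_neg]

/-- Riemann's kernel as a complex-valued function `Ψ : ℝ → ℂ`. [cite: LagariasMontague2011, eq. (3.4)] -/
def Psic (u : ℝ) : ℂ := Psi u

/-- `𝓕 Ψ (w) = ∫₀^∞ Ψ(v) c_{2πw}(v) dv` (`Ψ` is even). [folklore] -/
theorem fourier_Psic (w : ℝ) :
    𝓕 Psic w = ∫ v in Ioi 0, (Psi v : ℂ) * cosW (2 * π * w) v := by
  rw [Real.fourier_real_eq_integral_exp_smul]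
  have h1 : ∫ v : ℝ, cexp (↑(-2 * π * v * w) * I) • Psic v =
      ∫ v : ℝ, (Psi |v| : ℂ) * cexp (↑(-2 * π * v * w) * I) :=
    integral_congr_ae (ae_of_all _ fun v => by simp only [Psic, smul_eq_mul]; rw [mul_comm, Psi_abs])
  rw [h1]
  calc ∫ v : ℝ, (Psi |v| : ℂ) * cexp (↑(-2 * π * v * w) * I)
      = ∫ v in Ioi 0, (Psi v : ℂ) *
          (cexp (↑(-2 * π * v * w) * I) + cexp (↑(-2 * π * -v * w) * I)) :=
        integral_comp_abs_mul (F := fun v => (Psi v : ℂ))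
          (ω := fun v : ℝ => cexp (↑(-2 * π * v * w) * I)) (continuous_thetaSeries_ofReal _)
          (integrableOn_thetaSeries _).ofReal (by fun_prop)
          (fun v => le_of_eq (Complex.norm_exp_ofReal_mul_I _))
    _ = ∫ v in Ioi 0, (Psi v : ℂ) * cosW (2 * π * w) v := by
        refine setIntegral_congr_fun measurableSet_Ioi fun v _ => ?_
        rw [cosW, expLin, expLin, add_comm]
        congr 2 <;> (congr 1; push_cast; ring)

/-- **Riemann's Fourier representation of `Ξ`** (Riemann 1859; Titchmarsh (10.1.3)–(10.1.4);
Lagarias–Montague Lemma 3.1): `ξ(1/2 + it) = 𝓕 Ψ (t / 4π) = ∫_ℝ Ψ(u) e^{−itu/2} du`, i.e.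
`Ξ(t) = 2∫₀^∞ Φ(u) cos(tu) du` with `Φ(u) = 2Ψ(2u)`. [cite: Titchmarsh1986, §10.1 eq. (10.1.3)] -/
theorem riemannXi_criticalLine_eq_fourier (t : ℝ) :
    riemannXi (1 / 2 + t * I) = 𝓕 Psic (t / (4 * π)) := by
  have ha : 2 * π * (t / (4 * π)) = t / 2 := by
    field_simp
    ring
  rw [fourier_Psic, ha, integral_Psi_mul_cosW, riemannXi, completedRiemannZeta₀_criticalLine,
    fourier_mellinSide, ha]
  set H := ∫ u in Ioi 0, (thetaH u : ℂ) * cosW (t / 2) u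
  push_cast
  linear_combination (H * (t : ℂ) ^ 2 / 4) * I_mul_I

/-! ## Fourier inversion: `∫_ℝ Ξ = 4π Ψ(0)` -/

/-- `Ψ : ℝ → ℂ` is continuous. [folklore] -/
theorem continuous_Psic : Continuous Psic := continuous_thetaSeries_ofReal _

/-- `Ψ` is integrable. [folklore] -/
theorem integrable_Psic : Integrable Psic := integrable_Psi.ofReal

/-- `Ψ' = S_{δ(2X²−3X)}`. [folklore] -/
theorem hasDerivAt_Psic (u : ℝ) : HasDerivAt Psic ((thetaSeries (thetaδ psiPoly) u : ℂ)) u :=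
  (hasDerivAt_thetaSeries psiPoly u).ofReal_comp

/-- `deriv Ψ`. [folklore] -/
theorem deriv_Psic : deriv Psic = fun u => ((thetaSeries (thetaδ psiPoly) u : ℝ) : ℂ) :=
  funext fun u => (hasDerivAt_Psic u).deriv

/-- `Ψ` is differentiable. [folklore] -/
theorem differentiable_Psic : Differentiable ℝ Psic := fun u => (hasDerivAt_Psic u).differentiableAt

/-- `deriv (deriv Ψ) = S_{δδ(2X²−3X)}`. [folklore] -/
theorem deriv_deriv_Psic :
    deriv (deriv Psic) = fun u => ((thetaSeries (thetaδ (thetaδ psiPoly)) u : ℝ) : ℂ) := by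
  rw [deriv_Psic]
  funext u
  exact ((hasDerivAt_thetaSeries _ u).ofReal_comp).deriv

/-- `deriv Ψ` is differentiable. [folklore] -/
theorem differentiable_deriv_Psic : Differentiable ℝ (deriv Psic) := by
  rw [deriv_Psic]
  exact fun u => ((hasDerivAt_thetaSeries _ u).ofReal_comp).differentiableAt

/-- `deriv Ψ` is integrable. [folklore] -/
theorem integrable_deriv_Psic : Integrable (deriv Psic) := by
  rw [deriv_Psic]
  exact integrable_deriv_Psi.ofReal

/-- `deriv (deriv Ψ)` is integrable. [folklore] -/
theorem integrable_deriv_deriv_Psic : Integrable (deriv (deriv Psic)) := by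
  rw [deriv_deriv_Psic]
  exact integrable_deriv_deriv_Psi.ofReal

/-- `𝓕 Ψ'' (w) = (2πiw)² 𝓕 Ψ (w)`. [folklore] -/
theorem fourier_deriv_deriv_Psic (w : ℝ) :
    𝓕 (deriv (deriv Psic)) w = (2 * π * I * w) ^ 2 * 𝓕 Psic w := by
  rw [Real.fourier_deriv integrable_deriv_Psic differentiable_deriv_Psic integrable_deriv_deriv_Psic]
  dsimp only
  rw [Real.fourier_deriv integrable_Psic differentiable_Psic integrable_deriv_Psic]
  simp only [smul_eq_mul]
  ring

/-- The decay constant `C_Ψ := ‖Ψ‖₁ + ‖Ψ''‖₁/(4π²)`. [folklore] -/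
def fourierDecayConst : ℝ := (∫ u, ‖Psic u‖) + (∫ u, ‖deriv (deriv Psic) u‖) / (4 * π ^ 2)

/-- `|𝓕 Ψ (w)| ≤ C_Ψ / (1 + w²)` (two derivatives under the Fourier transform). [folklore] -/
theorem norm_fourier_Psic_le (w : ℝ) : ‖𝓕 Psic w‖ ≤ fourierDecayConst * (1 + w ^ 2)⁻¹ := by
  have h0 : ‖𝓕 Psic w‖ ≤ ∫ u, ‖Psic u‖ :=
    VectorFourier.norm_fourierIntegral_le_integral_norm _ _ _ _ _
  have h2 : ‖𝓕 (deriv (deriv Psic)) w‖ ≤ ∫ u, ‖deriv (deriv Psic) u‖ :=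
    VectorFourier.norm_fourierIntegral_le_integral_norm _ _ _ _ _
  rw [fourier_deriv_deriv_Psic] at h2
  simp only [norm_mul, norm_pow, Complex.norm_real, Complex.norm_I, mul_one, Complex.norm_ofNat,
    Real.norm_eq_abs, abs_of_pos pi_pos] at h2
  have hπ : 0 < 4 * π ^ 2 := by positivity
  rw [le_mul_inv_iff₀ (by positivity), fourierDecayConst]
  have h3 : w ^ 2 * ‖𝓕 Psic w‖ ≤ (∫ u, ‖deriv (deriv Psic) u‖) / (4 * π ^ 2) := by
    rw [le_div_iff₀ hπ]
    calc w ^ 2 * ‖𝓕 Psic w‖ * (4 * π ^ 2) = (2 * π * |w|) ^ 2 * ‖𝓕 Psic w‖ := by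
          rw [mul_pow, mul_pow, sq_abs]; ring
      _ ≤ ∫ u, ‖deriv (deriv Psic) u‖ := h2
  nlinarith [norm_nonneg (𝓕 Psic w)]

/-- `𝓕 Ψ` is continuous. [folklore] -/
theorem continuous_fourier_Psic : Continuous (𝓕 Psic) :=
  VectorFourier.fourierIntegral_continuous Real.continuous_fourierChar (by exact continuous_inner)
    integrable_Psic

/-- `𝓕 Ψ` is integrable. [folklore] -/
theorem integrable_fourier_Psic : Integrable (𝓕 Psic) :=
  Integrable.mono' (integrable_inv_one_add_sq.const_mul fourierDecayConst)
    continuous_fourier_Psic.aestronglyMeasurable (ae_of_all _ norm_fourier_Psic_le)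

/-- Fourier inversion at `0`: `∫_ℝ 𝓕 Ψ = Ψ(0)` ("by Fourier's integral theorem,
`Φ(u) = (1/π)∫₀^∞ Ξ(t) cos(ut) dt`", at `u = 0`). [cite: Titchmarsh1986, §10.4] -/
theorem integral_fourier_Psic : ∫ w, 𝓕 Psic w = (Psi 0 : ℂ) := by
  have := integrable_Psic.fourierInv_fourier_eq integrable_fourier_Psic
    (continuous_Psic.continuousAt (x := 0))
  rw [Real.fourierInv_eq'] at this
  simpa [Psic] using this

/-- `Ξ` is integrable on `ℝ`. [cite: LagariasMontague2011, Lemma 3.3 (1)] -/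
theorem integrable_riemannXi_criticalLine : Integrable fun t : ℝ => riemannXi (1 / 2 + t * I) := by
  have : (fun t : ℝ => riemannXi (1 / 2 + t * I)) = fun t => 𝓕 Psic (t / (4 * π)) :=
    funext riemannXi_criticalLine_eq_fourier
  rw [this]
  exact integrable_fourier_Psic.comp_div (by positivity)

/-- `∫_ℝ ξ(1/2 + it) dt = 4π Ψ(0)`. [cite: LagariasMontague2011, Thm. 2.1 (1)] -/
theorem integral_riemannXi_criticalLine : ∫ t : ℝ, riemannXi (1 / 2 + t * I) = 4 * π * Psi 0 := by
  simp_rw [riemannXi_criticalLine_eq_fourier]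
  rw [Measure.integral_comp_div (fun w => 𝓕 Psic w), integral_fourier_Psic,
    abs_of_pos (by positivity), Complex.real_smul]
  push_cast
  ring

/-- `Ξ` is even: `ξ(1/2 − it) = ξ(1/2 + it)`. [folklore] -/
theorem riemannXi_criticalLine_neg (t : ℝ) :
    riemannXi (1 / 2 + ((-t : ℝ) : ℂ) * I) = riemannXi (1 / 2 + t * I) := by
  rw [← riemannXi_one_sub (1 / 2 + t * I)]
  congr 1
  push_cast
  ring

/-- **`∫₀^∞ ξ(1/2 + it) dt = 2π Ψ(0)`** (`= π Φ(0) = A₀` in the notation of Lagarias–Montague).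
[cite: LagariasMontague2011, Thm. 2.1 (1)] -/
theorem integral_riemannXi_criticalLine_Ioi :
    ∫ t in Ioi (0 : ℝ), riemannXi (1 / 2 + t * I) = 2 * π * Psi 0 := by
  have h := integral_eq_two_mul_Ioi_of_even integrable_riemannXi_criticalLine
    riemannXi_criticalLine_neg
  rw [integral_riemannXi_criticalLine] at h
  linear_combination (-(1 : ℂ) / 2) * h

/-! ## Riemann's cosine integral in the notation of the sources -/

/-- `c_a(v) = 2 cos(av)`. [folklore] -/
theorem cosW_eq_two_mul_cos (a v : ℝ) : cosW a v = 2 * (Real.cos (a * v) : ℂ) := by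
  rw [cosW, expLin, expLin, Complex.ofReal_cos, Complex.two_cos]
  congr 1 <;> (congr 1; push_cast; ring)

/-- Riemann's kernel in the normalisation of Titchmarsh (10.1.4) / Lagarias–Montague (3.4):
`Φ(u) := 2Ψ(2u) = Σ_{n≥1} (4π²n⁴e^{9u/2} − 6πn²e^{5u/2}) e^{−πn²e^{2u}}`.
[cite: LagariasMontague2011, Lemma 3.1 eq. (3.4)] -/
theorem two_mul_Psi_two_mul (u : ℝ) : 2 * Psi (2 * u) =
    ∑' n : ℕ, (4 * π ^ 2 * ((n : ℝ) + 1) ^ 4 * rexp (9 / 2 * u) -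
      6 * π * ((n : ℝ) + 1) ^ 2 * rexp (5 / 2 * u)) * rexp (-(π * ((n : ℝ) + 1) ^ 2 * rexp (2 * u))) := by
  rw [Psi, thetaSeries, ← tsum_mul_left]
  refine tsum_congr fun n => ?_
  have e9 : rexp (9 / 2 * u) = rexp (2 * u) * rexp (2 * u) * rexp (2 * u / 4) := by
    rw [← Real.exp_add, ← Real.exp_add]; congr 1; ring
  have e5 : rexp (5 / 2 * u) = rexp (2 * u) * rexp (2 * u / 4) := by
    rw [← Real.exp_add]; congr 1; ring
  simp only [thetaTerm, eval_psiPoly, thetaWeight]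
  rw [e9, e5, sub_eq_add_neg (2 * u / 4), Real.exp_add]
  ring

/-- **Riemann's cosine integral** as printed: `ξ(1/2 + it) = 2∫₀^∞ Φ(u) cos(tu) du` with
`Φ(u) = 2Ψ(2u)` the series of `two_mul_Psi_two_mul` (Titchmarsh (10.1.3)–(10.1.4); Lagarias–Montague
Lemma 3.1, eqs. (3.3)–(3.4)). [cite: LagariasMontague2011, Lemma 3.1 eq. (3.3)] -/
theorem riemannXi_criticalLine_eq_integral_cos (t : ℝ) : riemannXi (1 / 2 + t * I) =
    ((2 * ∫ u in Ioi (0 : ℝ), 2 * Psi (2 * u) * Real.cos (t * u) : ℝ) : ℂ) := by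
  have ha : 2 * π * (t / (4 * π)) = t / 2 := by
    field_simp
    ring
  rw [riemannXi_criticalLine_eq_fourier, fourier_Psic, ha]
  have hsub := integral_comp_mul_left_Ioi (fun v : ℝ => (Psi v : ℂ) * cosW (t / 2) v) 0 two_pos
  rw [mul_zero] at hsub
  have h2 : ∫ x in Ioi (0 : ℝ), (Psi x : ℂ) * cosW (t / 2) x =
      2 * ∫ x in Ioi (0 : ℝ), (Psi (2 * x) : ℂ) * cosW (t / 2) (2 * x) := by
    rw [hsub, Complex.real_smul]
    push_cast
    ring
  rw [h2]
  push_cast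
  rw [← integral_complex_ofReal]
  congr 1
  refine setIntegral_congr_fun measurableSet_Ioi fun x _ => ?_
  have hx : t / 2 * (2 * x) = t * x := by ring
  rw [cosW_eq_two_mul_cos, hx]
  push_cast
  ring

end LagariasMontague

end Literature.NumberTheory.LFunctions
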